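import Summits.KontsevichZagierPeriods.KontsevichZagierPeriods.Theses.GenericPointClass
import Summits.KontsevichZagierPeriods.KontsevichZagierPeriods.Theorems.GaussManinCertificatesKZStokesBox
import Summits.KontsevichZagierPeriods.KontsevichZagierPeriods.Theorems.UnfoldedStokesStokesGenerationStubBoxToCube
import Literature.NumberTheory.Transcendental.KZLogCalculusProofs
import Literature.NumberTheory.Transcendental.KZUnfoldedStokesProofs
import Literature.NumberTheory.Transcendental.KZGroundingRelations

/-!
# Crux `ExactDescentBox` (stmt-KontsevichZagierPeriods-4427) — strategist line `affine_cube`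

Route `GenericPointClass`, crux #4 (the ENGINE, "Theorem B on boxes").

## The line: TRANSFER TO THE UNIT CUBE, WHERE THE ENGINE IS ALREADY KERNEL-CHECKED

The sibling crux `CobordismMove.CubeStokes` (stmt-5566) has a complete sorry-free proof in the
tree workfile `Cruxes/CubeStokes/CubeStokesProof.lean` (strategist seat cstrat-5566, 2026-08-17;
`lean check` rc 0, 0 sorry), cut into the three ledger items
`CubeLastNewtonLeibniz` (stmt-17771), `CubeCoordinateCycle` (stmt-17772), `ZeroCombination`
(stmt-17773), each proved in §1–§3 of that file and waiting only for a prover to land the file as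
`Theorems/CobordismMoveCubeStokes.lean`. The present crux is the BOX version WITH BULK TERM of the
same engine. This line moves the whole crux to the unit cube by ONE diagonal affine change of
variables `x ↦ a + (b − a)·x` (rule (2); the corners of a `ℚ`-semialgebraic open box are algebraic,
`GaussManinCertificates.isAlgebraic_corner_of_isSemialgebraic_openBox`, so the chart is a
`ℚ`-semialgebraic map — the LANDED toolkit `boxAff_*` of
`Theorems/UnfoldedStokesStokesGenerationStubBoxToCube.lean`, which proves the CLOSED-box version
`stub_boxToCube`), and then runs the cube engine verbatim:

* `stub_openBoxToCube : OpenBoxToCube` — a representation on the OPEN box `∏ (lᵢ, uᵢ)` with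
  algebraic corners is congruent mod `KZ.relations` to the open-unit-cube representation with
  integrand `(∏ (uᵢ − lᵢ)) · f(l + (u − l)·x)`. NEW, size S–M; template: the landed
  `stub_boxToCube` (closed box, 60 lines) with `Ioo` for `Icc`.
* `stub_cubeCoordinateCycle : CubeCoordinateCycle` — VERBATIM the statement of item stmt-17772
  (cycling a coordinate of the open unit cube to the last slot is one rule-(2) move, arbitrary
  integrand); PROVED in `CubeStokesProof.lean` §2 (`CubeCoordinateCycle.cubeCoordinateCycle_proof`).
* `stub_cubeLastNewtonLeibniz : CubeLastNewtonLeibniz` — VERBATIM the statement of item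
  stmt-17771 (Newton–Leibniz along the last coordinate of the open unit cube, bulk term included);
  PROVED in `CubeStokesProof.lean` §3 (`CubeLastNewtonLeibniz.cubeLastNewtonLeibniz_proof`).

Once a prover lands `Theorems/CobordismMoveCubeStokes.lean` (instruction on file at stmt-5566),
stubs 2 and 3 close by `exact`, and the crux is reduced to the single new stub 1.

The sorry-free glue below carries all the bookkeeping: `cubeSingleCoordinateDescent` (descent along
one coordinate `k` on the unit cube from stubs 2+3: transport of the potential through the
coordinate cycle, honest face representations `[(0,1)ⁿ, B(x_k = 0)]`, `[(0,1)ⁿ, B(x_k = 1)]` built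
from continuity on the compact closed cube, recombination of the two faces by rule (1b)),
`boxSingleCoordinateDescent` (affine transport of the potential `A ↦ (∏_{j≠k}(b_j − a_j))·(A ∘ Φ)`,
of its fibrewise derivative by the one-variable chain rule, and of the face representation by stub 1
in dimension `n`), and the assembly `ExactDescentBox_of` (finite-sum bookkeeping by the tree theorem
`KZ.of_sub_sum_integrand_mem_relations`). Sorries live ONLY in the three `stub_*` theorems.

Why it dodges the open stubs of the live line `birth` (`stub_closeLastCoordinate`,
`stub_newtonLeibnizBand`, `stub_transportToLast`) and of line `relabel_nl` (`stub_boxRelabel`,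
`stub_boxLastNewtonLeibniz`): those re-prove the band / null-face / Newton–Leibniz / permutation
mechanics ON A GENERAL BOX; here that mechanics is consumed on the unit cube, where it is already
kernel-checked, and the only box-specific step left is a diagonal affine rule-(2) move whose
closed-box twin is landed.

Disproof used: none on file for this crux (`ledger crux ls`: no `Disproof.lean`); the negatives
index of the summit has no statement about boxes / divergences / affine charts.
-/

noncomputable section

open MeasureTheory Set
open Literature.NumberTheory.Transcendental
open Literature.ModelTheory.ExponentialFields (IsSemialgebraic)
open Summit.KontsevichZagierPeriods.GaussManinCertificates
  (isAlgebraic_corner_of_isSemialgebraic_openBox isSemialgebraic_openBox_of_isAlgebraic)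
open Summit.KontsevichZagierPeriods.KontsevichZagierPeriods.Cruxes.StokesGeneration.FibrewiseStokes
  (boxAff_isSemialgebraicMapOn boxAff_isAlgebraic_prod)

namespace Summit.KontsevichZagierPeriods.KontsevichZagierPeriods.Cruxes.ExactDescentBox.AffineCube

/-! ### The stub statements -/

/-- **Affine cubification of an OPEN box with algebraic corners (one rule-(2) move).** A
representation `r` on the open box `∏ᵢ (lᵢ, uᵢ)` (`lᵢ < uᵢ` real algebraic) is congruent modulo
`KZ.relations` to an open-unit-cube representation `t` with integrand
`(∏ᵢ (uᵢ − lᵢ)) · r.integrand (l + (u − l)·x)` (the chart `x ↦ l + (u − l)·x`, constant Jacobian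
`∏ᵢ (uᵢ − lᵢ) > 0`). Open-box twin of the landed `StokesGeneration.FibrewiseStokes.stub_boxToCube`. -/
def OpenBoxToCube : Prop :=
  ∀ (N : ℕ) (l u : Fin N → ℝ) (r : KZ.IntegralRep N), (∀ i, IsAlgebraic ℚ (l i)) →
    (∀ i, IsAlgebraic ℚ (u i)) → (∀ i, l i < u i) →
    r.domain = {x | ∀ i, x i ∈ Set.Ioo (l i) (u i)} →
    ∃ t : KZ.IntegralRep N, t.domain = {x | ∀ i, x i ∈ Set.Ioo (0 : ℝ) 1} ∧
      (∀ x ∈ t.domain,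
        t.integrand x = (∏ i, (u i - l i)) * r.integrand (fun i => l i + (u i - l i) * x i)) ∧
      KZ.of r - KZ.of t ∈ KZ.relations

/-- **Cycling a coordinate of the open unit cube to the last slot is a move** — VERBATIM the
statement of item stmt-KontsevichZagierPeriods-17772 (`CobordismMove.CubeCoordinateCycle`), proved
in `Cruxes/CubeStokes/CubeStokesProof.lean` §2. -/
def CubeCoordinateCycle : Prop :=
  ∀ (d : ℕ) (k : Fin (d + 1)) (R R' : Literature.NumberTheory.Transcendental.KZ.IntegralRep (d + 1)),
    R.domain = {x : Fin (d + 1) → ℝ | ∀ i, x i ∈ Set.Ioo (0 : ℝ) 1} →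
    R'.domain = {x : Fin (d + 1) → ℝ | ∀ i, x i ∈ Set.Ioo (0 : ℝ) 1} →
    Set.EqOn R'.integrand (fun z => R.integrand (Fin.insertNth k (z (Fin.last d)) (Fin.init z)))
      R'.domain →
    Literature.NumberTheory.Transcendental.KZ.of R - Literature.NumberTheory.Transcendental.KZ.of R' ∈
      Literature.NumberTheory.Transcendental.KZ.relations

/-- **Newton–Leibniz along the last coordinate of the open unit cube, bulk term included** —
VERBATIM the statement of item stmt-KontsevichZagierPeriods-17771
(`CobordismMove.CubeLastNewtonLeibniz`), proved in `Cruxes/CubeStokes/CubeStokesProof.lean` §3. -/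
def CubeLastNewtonLeibniz : Prop :=
  ∀ (d : ℕ) (A A' : (Fin (d + 1) → ℝ) → ℝ)
    (R : Literature.NumberTheory.Transcendental.KZ.IntegralRep (d + 1))
    (r₀ r₁ : Literature.NumberTheory.Transcendental.KZ.IntegralRep d),
    Literature.NumberTheory.Transcendental.IsSemialgebraicFunOn ℚ (Set.Icc (0 : Fin (d + 1) → ℝ) 1) A →
    ContinuousOn A (Set.Icc (0 : Fin (d + 1) → ℝ) 1) →
    (∀ y ∈ {y : Fin d → ℝ | ∀ i, y i ∈ Set.Ioo (0 : ℝ) 1}, ∀ t ∈ Set.Ioo (0 : ℝ) 1,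
      HasDerivAt (fun s : ℝ => A (Fin.snoc y s)) (A' (Fin.snoc y t)) t) →
    R.domain = {x : Fin (d + 1) → ℝ | ∀ i, x i ∈ Set.Ioo (0 : ℝ) 1} →
    Set.EqOn R.integrand A' R.domain →
    r₀.domain = {y : Fin d → ℝ | ∀ i, y i ∈ Set.Ioo (0 : ℝ) 1} →
    r₁.domain = {y : Fin d → ℝ | ∀ i, y i ∈ Set.Ioo (0 : ℝ) 1} →
    Set.EqOn r₀.integrand (fun y => A (Fin.snoc y 0)) r₀.domain →
    Set.EqOn r₁.integrand (fun y => A (Fin.snoc y 1)) r₁.domain →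
    Literature.NumberTheory.Transcendental.KZ.of R - Literature.NumberTheory.Transcendental.KZ.of r₁ +
      Literature.NumberTheory.Transcendental.KZ.of r₀ ∈
        Literature.NumberTheory.Transcendental.KZ.relations

/-! ### Registered stubs (the ONLY sorries of this file) -/

/-- Stub 1 (NEW; hardest of the line only because the other two are already proved): affine
cubification of an open box with algebraic corners. Template: the landed closed-box twin
`StokesGeneration.FibrewiseStokes.stub_boxToCube` (same chart, `boxAff_*` toolkit). Size S–M. -/
theorem stub_openBoxToCube : OpenBoxToCube := by
  sorry

/-- Stub 2: `CubeCoordinateCycle` (item stmt-17772; proof on file: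
`CobordismMove.CubeCoordinateCycle.cubeCoordinateCycle_proof`, CubeStokesProof.lean §2). -/
theorem stub_cubeCoordinateCycle : CubeCoordinateCycle := by
  sorry

/-- Stub 3: `CubeLastNewtonLeibniz` (item stmt-17771; proof on file:
`CobordismMove.CubeLastNewtonLeibniz.cubeLastNewtonLeibniz_proof`, CubeStokesProof.lean §3). -/
theorem stub_cubeLastNewtonLeibniz : CubeLastNewtonLeibniz := by
  sorry

/-! ### Sorry-free glue, part 1: coordinate cycles on the unit cube -/

variable {d : ℕ}

/-- The coordinate cycle `z ↦ Fin.insertNth k (z last) (Fin.init z)` of `ℝᵈ⁺¹` is a relabelling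
of coordinates along an index permutation. [folklore] -/
theorem exists_perm_insertNth (k : Fin (d + 1)) :
    ∃ e : Equiv.Perm (Fin (d + 1)), ∀ z : Fin (d + 1) → ℝ,
      (fun i => z (e i)) = (Fin.insertNth k (z (Fin.last d)) (Fin.init z) : Fin (d + 1) → ℝ) := by
  refine ⟨(finSuccEquiv' k).trans (finSuccEquiv' (Fin.last d)).symm, fun z => ?_⟩
  funext i
  rcases Fin.eq_self_or_eq_succAbove k i with rfl | ⟨j, rfl⟩
  · simp [finSuccEquiv'_at, finSuccEquiv'_symm_none, Fin.insertNth_apply_same]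
  · simp [finSuccEquiv'_succAbove, finSuccEquiv'_symm_some, Fin.insertNth_apply_succAbove,
      Fin.succAbove_last, Fin.init]

/-- The open unit cube is invariant under relabelling coordinates. [folklore] -/
theorem comp_perm_mem_setOf_iff {N : ℕ} (e : Equiv.Perm (Fin N)) (z : Fin N → ℝ) :
    (fun i => z (e i)) ∈ {x : Fin N → ℝ | ∀ i, x i ∈ Ioo (0 : ℝ) 1} ↔
      z ∈ {x : Fin N → ℝ | ∀ i, x i ∈ Ioo (0 : ℝ) 1} := by
  simp only [mem_setOf_eq]
  exact ⟨fun h i => by simpa using h (e.symm i), fun h i => h (e i)⟩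

/-- The closed unit cube is invariant under relabelling coordinates. [folklore] -/
theorem comp_perm_mem_Icc_iff {N : ℕ} (e : Equiv.Perm (Fin N)) (z : Fin N → ℝ) :
    (fun i => z (e i)) ∈ Icc (0 : Fin N → ℝ) 1 ↔ z ∈ Icc (0 : Fin N → ℝ) 1 := by
  simp only [mem_Icc, Pi.le_def, Pi.zero_apply, Pi.one_apply]
  constructor
  · rintro ⟨h0, h1⟩
    exact ⟨fun i => by simpa using h0 (e.symm i), fun i => by simpa using h1 (e.symm i)⟩
  · rintro ⟨h0, h1⟩
    exact ⟨fun i => h0 (e i), fun i => h1 (e i)⟩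

/-- Semialgebraicity on the open unit cube is invariant under relabelling coordinates. [folklore] -/
theorem isSemialgebraicFunOn_comp_perm_setOf {N : ℕ} (e : Equiv.Perm (Fin N))
    {f : (Fin N → ℝ) → ℝ} (hf : IsSemialgebraicFunOn ℚ {x : Fin N → ℝ | ∀ i, x i ∈ Ioo (0 : ℝ) 1} f) :
    IsSemialgebraicFunOn ℚ {x : Fin N → ℝ | ∀ i, x i ∈ Ioo (0 : ℝ) 1}
      (fun z => f (fun i => z (e i))) := by
  have h := hf.comp_equiv e
  have hset : {w : Fin N → ℝ | (fun i => w (e i)) ∈ {x : Fin N → ℝ | ∀ i, x i ∈ Ioo (0 : ℝ) 1}} =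
      {x : Fin N → ℝ | ∀ i, x i ∈ Ioo (0 : ℝ) 1} := by
    ext w
    exact comp_perm_mem_setOf_iff e w
  rwa [hset] at h

/-- Semialgebraicity on the closed unit cube is invariant under relabelling coordinates. [folklore] -/
theorem isSemialgebraicFunOn_comp_perm_Icc {N : ℕ} (e : Equiv.Perm (Fin N))
    {f : (Fin N → ℝ) → ℝ} (hf : IsSemialgebraicFunOn ℚ (Icc (0 : Fin N → ℝ) 1) f) :
    IsSemialgebraicFunOn ℚ (Icc (0 : Fin N → ℝ) 1) (fun z => f (fun i => z (e i))) := by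
  have h := hf.comp_equiv e
  have hset : {w : Fin N → ℝ | (fun i => w (e i)) ∈ Icc (0 : Fin N → ℝ) 1} =
      Icc (0 : Fin N → ℝ) 1 := by
    ext w
    exact comp_perm_mem_Icc_iff e w
  rwa [hset] at h

/-- Relabelling coordinates is continuous. [folklore] -/
theorem continuous_comp_perm {N : ℕ} (e : Equiv.Perm (Fin N)) :
    Continuous (fun z : Fin N → ℝ => fun i => z (e i)) :=
  continuous_pi fun i => continuous_apply (e i)

/-- Absolute integrability on the open unit cube is invariant under relabelling coordinates (the
relabelling is the volume-preserving `MeasurableEquiv.piCongrLeft` and preserves the cube).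
[folklore] -/
theorem integrableOn_comp_perm_setOf {N : ℕ} (e : Equiv.Perm (Fin N)) {f : (Fin N → ℝ) → ℝ}
    (hf : IntegrableOn f {x : Fin N → ℝ | ∀ i, x i ∈ Ioo (0 : ℝ) 1}) :
    IntegrableOn (fun z => f (fun i => z (e i))) {x : Fin N → ℝ | ∀ i, x i ∈ Ioo (0 : ℝ) 1} := by
  set L : (Fin N → ℝ) ≃ᵐ (Fin N → ℝ) := MeasurableEquiv.piCongrLeft (fun _ : Fin N => ℝ) e.symm
    with hL_def
  have hL : MeasurePreserving L volume volume :=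
    volume_measurePreserving_piCongrLeft (fun _ : Fin N => ℝ) e.symm
  have hLapply : ∀ z : Fin N → ℝ, L z = fun i => z (e i) := by
    intro z
    funext i
    have h := Equiv.piCongrLeft_apply_apply (fun _ : Fin N => ℝ) e.symm z (e i)
    rw [hL_def, MeasurableEquiv.coe_piCongrLeft]
    simpa using h
  have hpre : L ⁻¹' {x : Fin N → ℝ | ∀ i, x i ∈ Ioo (0 : ℝ) 1} =
      {x : Fin N → ℝ | ∀ i, x i ∈ Ioo (0 : ℝ) 1} := by
    ext z
    rw [mem_preimage, hLapply]
    exact comp_perm_mem_setOf_iff e z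
  have h := (hL.integrableOn_comp_preimage L.measurableEmbedding (f := f)
    (s := {x : Fin N → ℝ | ∀ i, x i ∈ Ioo (0 : ℝ) 1})).mpr hf
  rw [hpre] at h
  exact h.congr_fun (fun z _ => by simp only [Function.comp_apply, hLapply])
    (KZ.isOpen_unitCube N).measurableSet

/-- Updating the inserted coordinate. [folklore] -/
theorem update_insertNth (k : Fin (d + 1)) (t s : ℝ) (y : Fin d → ℝ) :
    Function.update (Fin.insertNth k t y : Fin (d + 1) → ℝ) k s = Fin.insertNth k s y := by
  funext i
  rcases Fin.eq_self_or_eq_succAbove k i with rfl | ⟨j, rfl⟩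
  · simp [Fin.insertNth_apply_same]
  · rw [Function.update_of_ne (Fin.succAbove_ne k j)]
    simp [Fin.insertNth_apply_succAbove]

/-- Inserting a coordinate in `(0,1)` into a point of the open `d`-cube gives a point of the open
`(d+1)`-cube. [folklore] -/
theorem insertNth_mem_setOf (k : Fin (d + 1)) {t : ℝ} (ht : t ∈ Ioo (0 : ℝ) 1) {y : Fin d → ℝ}
    (hy : y ∈ {y : Fin d → ℝ | ∀ i, y i ∈ Ioo (0 : ℝ) 1}) :
    (Fin.insertNth k t y : Fin (d + 1) → ℝ) ∈ {x : Fin (d + 1) → ℝ | ∀ i, x i ∈ Ioo (0 : ℝ) 1} := by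
  simp only [mem_setOf_eq] at hy ⊢
  intro i
  rcases Fin.eq_self_or_eq_succAbove k i with rfl | ⟨j, rfl⟩
  · simpa [Fin.insertNth_apply_same] using ht
  · simpa [Fin.insertNth_apply_succAbove] using hy j

/-! ### Sorry-free glue, part 2: honest face representations on the unit cube -/

/-- Inserting a coordinate in `[0,1]` into a point of the open `d`-cube gives a point of the
closed `(d+1)`-cube. [folklore] -/
theorem insertNth_mem_Icc_of_mem_setOf (k : Fin (d + 1)) {c : ℝ} (hc : c ∈ Icc (0 : ℝ) 1)
    {y : Fin d → ℝ} (hy : y ∈ {y : Fin d → ℝ | ∀ i, y i ∈ Ioo (0 : ℝ) 1}) :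
    (Fin.insertNth k c y : Fin (d + 1) → ℝ) ∈ Icc (0 : Fin (d + 1) → ℝ) 1 := by
  simp only [mem_setOf_eq] at hy
  rw [mem_Icc, Pi.le_def, Pi.le_def]
  constructor
  · intro i
    rcases Fin.eq_self_or_eq_succAbove k i with rfl | ⟨j, rfl⟩
    · simpa [Fin.insertNth_apply_same] using hc.1
    · simpa [Fin.insertNth_apply_succAbove] using (hy j).1.le
  · intro i
    rcases Fin.eq_self_or_eq_succAbove k i with rfl | ⟨j, rfl⟩
    · simpa [Fin.insertNth_apply_same] using hc.2
    · simpa [Fin.insertNth_apply_succAbove] using (hy j).2.le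

/-- Inserting a coordinate in `[0,1]` into a point of the closed `d`-cube gives a point of the
closed `(d+1)`-cube. [folklore] -/
theorem insertNth_mem_Icc_of_mem_Icc (k : Fin (d + 1)) {c : ℝ} (hc : c ∈ Icc (0 : ℝ) 1)
    {y : Fin d → ℝ} (hy : y ∈ Icc (0 : Fin d → ℝ) 1) :
    (Fin.insertNth k c y : Fin (d + 1) → ℝ) ∈ Icc (0 : Fin (d + 1) → ℝ) 1 := by
  rw [mem_Icc, Pi.le_def, Pi.le_def] at hy ⊢
  obtain ⟨h0, h1⟩ := hy
  constructor
  · intro i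
    rcases Fin.eq_self_or_eq_succAbove k i with rfl | ⟨j, rfl⟩
    · simpa [Fin.insertNth_apply_same] using hc.1
    · simpa [Fin.insertNth_apply_succAbove] using h0 j
  · intro i
    rcases Fin.eq_self_or_eq_succAbove k i with rfl | ⟨j, rfl⟩
    · simpa [Fin.insertNth_apply_same] using hc.2
    · simpa [Fin.insertNth_apply_succAbove] using h1 j

/-- The face embedding `y ↦ insertNth k c y` (rational `c`) is a `ℚ`-semialgebraic map on every
`ℚ`-semialgebraic set: its coordinates are the constant `c` and the coordinate functions.
[folklore] -/
theorem isSemialgebraicMapOn_insertNth (k : Fin (d + 1)) (c : ℚ) {σ : Set (Fin d → ℝ)}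
    (hσ : IsSemialgebraic ℚ σ) :
    IsSemialgebraicMapOn ℚ σ (fun y : Fin d → ℝ => (Fin.insertNth k (c : ℝ) y : Fin (d + 1) → ℝ)) := by
  refine IsSemialgebraicMapOn.of_forall hσ fun j => ?_
  rcases Fin.eq_self_or_eq_succAbove k j with rfl | ⟨i, rfl⟩
  · simp only [Fin.insertNth_apply_same]
    exact isSemialgebraicFunOn_ratCast hσ c
  · simp only [Fin.insertNth_apply_succAbove]
    exact isSemialgebraicFunOn_apply hσ i

/-- The face embedding `y ↦ insertNth k c y` is continuous. [folklore] -/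
theorem continuous_insertNth_right (k : Fin (d + 1)) (c : ℝ) :
    Continuous (fun y : Fin d → ℝ => (Fin.insertNth k c y : Fin (d + 1) → ℝ)) := by
  refine continuous_pi fun j => ?_
  rcases Fin.eq_self_or_eq_succAbove k j with rfl | ⟨i, rfl⟩
  · simp only [Fin.insertNth_apply_same]
    exact continuous_const
  · simp only [Fin.insertNth_apply_succAbove]
    exact continuous_apply i

/-- **Honest face representations.** For `B` `ℚ`-semialgebraic and continuous on the closed unit
`(d+1)`-cube and a rational height `c ∈ [0,1]`, the face function `y ↦ B (insertNth k c y)` is the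
integrand of a representation on the open unit `d`-cube (semialgebraic by composition with the
polynomial face embedding; integrable because continuous on the compact closed `d`-cube).
[folklore] -/
theorem exists_faceRep (k : Fin (d + 1)) (c : ℚ) (hc : ((c : ℝ)) ∈ Icc (0 : ℝ) 1)
    {B : (Fin (d + 1) → ℝ) → ℝ} (hB : IsSemialgebraicFunOn ℚ (Icc (0 : Fin (d + 1) → ℝ) 1) B)
    (hBc : ContinuousOn B (Icc (0 : Fin (d + 1) → ℝ) 1)) :
    ∃ r : KZ.IntegralRep d, r.domain = {y : Fin d → ℝ | ∀ i, y i ∈ Ioo (0 : ℝ) 1} ∧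
      r.integrand = fun y => B (Fin.insertNth k (c : ℝ) y) := by
  have hUd : IsSemialgebraic ℚ {y : Fin d → ℝ | ∀ i, y i ∈ Ioo (0 : ℝ) 1} :=
    KZ.isSemialgebraic_unitCube d
  have hsa : IsSemialgebraicFunOn ℚ {y : Fin d → ℝ | ∀ i, y i ∈ Ioo (0 : ℝ) 1}
      (fun y => B (Fin.insertNth k (c : ℝ) y)) :=
    (IsSemialgebraicFunOn.comp_isSemialgebraicMapOn_holds hB (isSemialgebraicMapOn_insertNth k c hUd)
      fun y hy => insertNth_mem_Icc_of_mem_setOf k hc hy).congr fun _ _ => rfl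
  have hcont : ContinuousOn (fun y => B (Fin.insertNth k (c : ℝ) y)) (Icc (0 : Fin d → ℝ) 1) :=
    hBc.comp (continuous_insertNth_right k c).continuousOn
      fun y hy => insertNth_mem_Icc_of_mem_Icc k hc hy
  have hint : IntegrableOn (fun y => B (Fin.insertNth k (c : ℝ) y))
      {y : Fin d → ℝ | ∀ i, y i ∈ Ioo (0 : ℝ) 1} :=
    (hcont.integrableOn_compact isCompact_Icc).mono_set (KZ.unitCube_subset_Icc d)
  exact ⟨⟨_, _, hUd, hsa, hint⟩, rfl, rfl⟩

/-! ### Sorry-free glue, part 3: descent along one coordinate on the unit cube -/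

/-- **Descent along one coordinate `k` on the open unit cube** from stubs 2 and 3: an integrand
`B'` which is `∂B/∂x_k` for a potential `B` semialgebraic and continuous on the closed cube descends
to the face representation `[(0,1)ⁿ, B(x_k = 1) − B(x_k = 0)]`. The potential and its derivative are
transported through the coordinate cycle `z ↦ insertNth k (z last) (init z)`; stub 2 moves the bulk,
stub 3 descends the cycled bulk to the two honest faces (`exists_faceRep`), rule (1b) recombines
them into the given face representation. [cite: KontsevichZagier2001, §1.2] -/
theorem cubeSingleCoordinateDescent (h₂ : CubeCoordinateCycle) (h₃ : CubeLastNewtonLeibniz)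
    (n : ℕ) (k : Fin (n + 1)) (B B' : (Fin (n + 1) → ℝ) → ℝ) (R : KZ.IntegralRep (n + 1))
    (s : KZ.IntegralRep n)
    (hRd : R.domain = {x : Fin (n + 1) → ℝ | ∀ i, x i ∈ Ioo (0 : ℝ) 1})
    (hB : IsSemialgebraicFunOn ℚ (Icc (0 : Fin (n + 1) → ℝ) 1) B)
    (hBc : ContinuousOn B (Icc (0 : Fin (n + 1) → ℝ) 1))
    (hder : ∀ z ∈ R.domain, HasDerivAt (fun t : ℝ => B (Function.update z k t)) (B' z) (z k))
    (hRi : EqOn R.integrand B' R.domain)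
    (hsd : s.domain = {y : Fin n → ℝ | ∀ i, y i ∈ Ioo (0 : ℝ) 1})
    (hsi : EqOn s.integrand (fun y => B (Fin.insertNth k 1 y) - B (Fin.insertNth k 0 y)) s.domain) :
    KZ.of R - KZ.of s ∈ KZ.relations := by
  obtain ⟨e, he⟩ := exists_perm_insertNth (d := n) k
  have hU : IsSemialgebraic ℚ {x : Fin (n + 1) → ℝ | ∀ i, x i ∈ Ioo (0 : ℝ) 1} :=
    KZ.isSemialgebraic_unitCube (n + 1)
  -- (a) the derivative on the open cube
  have hB'sa : IsSemialgebraicFunOn ℚ {x : Fin (n + 1) → ℝ | ∀ i, x i ∈ Ioo (0 : ℝ) 1} B' := by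
    have h := R.isSemialgebraicFunOn_integrand.congr hRi
    rwa [hRd] at h
  have hB'int : IntegrableOn B' {x : Fin (n + 1) → ℝ | ∀ i, x i ∈ Ioo (0 : ℝ) 1} := by
    have h := R.integrableOn.congr_fun hRi (KZ.IntegralRep.measurableSet_domain_holds R)
    rwa [hRd] at h
  -- (b) transport through the coordinate cycle
  have hCsa : IsSemialgebraicFunOn ℚ (Icc (0 : Fin (n + 1) → ℝ) 1)
      (fun z => B (Fin.insertNth k (z (Fin.last n)) (Fin.init z))) :=
    (isSemialgebraicFunOn_comp_perm_Icc e hB).congr fun z _ => congrArg B (he z)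
  have hC'sa : IsSemialgebraicFunOn ℚ {x : Fin (n + 1) → ℝ | ∀ i, x i ∈ Ioo (0 : ℝ) 1}
      (fun z => B' (Fin.insertNth k (z (Fin.last n)) (Fin.init z))) :=
    (isSemialgebraicFunOn_comp_perm_setOf e hB'sa).congr fun z _ => congrArg B' (he z)
  have hC'int : IntegrableOn (fun z => B' (Fin.insertNth k (z (Fin.last n)) (Fin.init z)))
      {x : Fin (n + 1) → ℝ | ∀ i, x i ∈ Ioo (0 : ℝ) 1} :=
    (integrableOn_comp_perm_setOf e hB'int).congr_fun (fun z _ => congrArg B' (he z))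
      (KZ.isOpen_unitCube (n + 1)).measurableSet
  have hCcont : ContinuousOn (fun z => B (Fin.insertNth k (z (Fin.last n)) (Fin.init z)))
      (Icc (0 : Fin (n + 1) → ℝ) 1) := by
    have h : ContinuousOn (fun z : Fin (n + 1) → ℝ => B (fun i => z (e i)))
        (Icc (0 : Fin (n + 1) → ℝ) 1) :=
      hBc.comp (continuous_comp_perm e).continuousOn fun z hz => (comp_perm_mem_Icc_iff e z).2 hz
    exact h.congr fun z _ => (congrArg B (he z)).symm
  have hCder : ∀ y ∈ {y : Fin n → ℝ | ∀ i, y i ∈ Ioo (0 : ℝ) 1}, ∀ t ∈ Ioo (0 : ℝ) 1,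
      HasDerivAt
        (fun σ : ℝ => B (Fin.insertNth k ((Fin.snoc y σ : Fin (n + 1) → ℝ) (Fin.last n))
          (Fin.init (Fin.snoc y σ : Fin (n + 1) → ℝ))))
        (B' (Fin.insertNth k ((Fin.snoc y t : Fin (n + 1) → ℝ) (Fin.last n))
          (Fin.init (Fin.snoc y t : Fin (n + 1) → ℝ)))) t := by
    intro y hy t ht
    simp only [Fin.snoc_last, Fin.init_snoc]
    have hx : (Fin.insertNth k t y : Fin (n + 1) → ℝ) ∈ R.domain := by
      rw [hRd]
      exact insertNth_mem_setOf k ht hy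
    have h := hder _ hx
    simp only [Fin.insertNth_apply_same, update_insertNth] at h
    exact h
  -- (c) the cycled bulk representation and stub 2
  let Rt : KZ.IntegralRep (n + 1) :=
    { domain := {x | ∀ i, x i ∈ Ioo (0 : ℝ) 1}
      integrand := fun z => B' (Fin.insertNth k (z (Fin.last n)) (Fin.init z))
      isSemialgebraic_domain := hU
      isSemialgebraicFunOn_integrand := hC'sa
      integrableOn := hC'int }
  have hcyc : KZ.of R - KZ.of Rt ∈ KZ.relations := by
    refine h₂ n k R Rt hRd rfl fun z hz => ?_
    have hmem : (Fin.insertNth k (z (Fin.last n)) (Fin.init z) : Fin (n + 1) → ℝ) ∈ R.domain := by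
      rw [hRd, ← he z]
      exact (comp_perm_mem_setOf_iff e z).2 hz
    exact (hRi hmem).symm
  -- (d) the two honest faces and stub 3
  obtain ⟨r₀, hr₀d, hr₀i⟩ := exists_faceRep (d := n) k 0 (by norm_num) hB hBc
  obtain ⟨r₁, hr₁d, hr₁i⟩ := exists_faceRep (d := n) k 1 (by norm_num) hB hBc
  have hNL : KZ.of Rt - KZ.of r₁ + KZ.of r₀ ∈ KZ.relations := by
    refine h₃ n (fun z => B (Fin.insertNth k (z (Fin.last n)) (Fin.init z)))
      (fun z => B' (Fin.insertNth k (z (Fin.last n)) (Fin.init z))) Rt r₀ r₁ hCsa hCcont hCder rfl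
      (fun _ _ => rfl) hr₀d hr₁d ?_ ?_
    · intro y _
      rw [hr₀i]
      simp
    · intro y _
      rw [hr₁i]
      simp
  -- (e) recombine the two faces into the given face representation
  have hsplit : KZ.of s - KZ.of r₁ - KZ.of r₀.neg ∈ KZ.relations := by
    refine KZ.integrandAddRel_subset_relations ⟨n, s, r₁, r₀.neg, by rw [hr₁d, hsd],
      by rw [KZ.IntegralRep.domain_neg, hr₀d, hsd], fun y hy => ?_, rfl⟩
    rw [hsi hy, Pi.add_apply, KZ.IntegralRep.integrand_neg, Pi.neg_apply, hr₁i, hr₀i]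
    simp only [Rat.cast_one, Rat.cast_zero]
    ring
  have hneg : KZ.of r₀.neg + KZ.of r₀ ∈ KZ.relations := by
    have h := KZ.of_add_of_mem_relations_of_eqOn_neg (r := r₀) (r' := r₀.neg)
      (KZ.IntegralRep.domain_neg r₀) (fun x _ => by rw [KZ.IntegralRep.integrand_neg])
    rwa [add_comm] at h
  have key : KZ.of R - KZ.of s = (KZ.of R - KZ.of Rt) + (KZ.of Rt - KZ.of r₁ + KZ.of r₀) -
      (KZ.of s - KZ.of r₁ - KZ.of r₀.neg) - (KZ.of r₀.neg + KZ.of r₀) := by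
    abel
  rw [key]
  exact KZ.relations.sub_mem (KZ.relations.sub_mem (KZ.relations.add_mem hcyc hNL) hsplit) hneg

/-! ### Sorry-free glue, part 4: the diagonal affine chart `x ↦ a + (b − a)·x` -/

/-- The affine chart commutes with updating a coordinate. [folklore] -/
theorem boxAff_update (a b : Fin (d + 1) → ℝ) (x : Fin (d + 1) → ℝ) (k : Fin (d + 1)) (t : ℝ) :
    (fun i => a i + (b i - a i) * Function.update x k t i) =
      Function.update (fun i => a i + (b i - a i) * x i) k (a k + (b k - a k) * t) := by
  funext i
  by_cases hik : i = k
  · subst hik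
    simp
  · simp [Function.update_of_ne hik]

/-- The affine chart commutes with inserting a coordinate: `Φ (insertNth k c y) =
insertNth k (a_k + (b_k − a_k) c) (Φ_k y)`, `Φ_k` the chart of the `k`-th face. [folklore] -/
theorem boxAff_insertNth (a b : Fin (d + 1) → ℝ) (k : Fin (d + 1)) (c : ℝ) (y : Fin d → ℝ) :
    (fun i => a i + (b i - a i) * (Fin.insertNth k c y : Fin (d + 1) → ℝ) i) =
      (Fin.insertNth k (a k + (b k - a k) * c)
        (fun j => a (k.succAbove j) + (b (k.succAbove j) - a (k.succAbove j)) * y j) :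
          Fin (d + 1) → ℝ) := by
  funext i
  rcases Fin.eq_self_or_eq_succAbove k i with rfl | ⟨j, rfl⟩
  · simp [Fin.insertNth_apply_same]
  · simp [Fin.insertNth_apply_succAbove]

/-- The affine chart maps the open unit cube into the open box. [folklore] -/
theorem boxAff_mem_openBox {N : ℕ} {a b : Fin N → ℝ} (hab : ∀ i, a i < b i) {x : Fin N → ℝ}
    (hx : x ∈ {x : Fin N → ℝ | ∀ i, x i ∈ Ioo (0 : ℝ) 1}) :
    (fun i => a i + (b i - a i) * x i) ∈ {z : Fin N → ℝ | ∀ i, z i ∈ Ioo (a i) (b i)} := by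
  intro i
  have h0 := (hx i).1
  have h1 := (hx i).2
  have hd := sub_pos.2 (hab i)
  constructor <;> nlinarith

/-- The affine chart maps the closed unit cube into the closed box. [folklore] -/
theorem boxAff_mem_closedBox {N : ℕ} {a b : Fin N → ℝ} (hab : ∀ i, a i < b i) {x : Fin N → ℝ}
    (hx : x ∈ Icc (0 : Fin N → ℝ) 1) :
    (fun i => a i + (b i - a i) * x i) ∈ {z : Fin N → ℝ | ∀ j, z j ∈ Icc (a j) (b j)} := by
  rw [mem_Icc, Pi.le_def, Pi.le_def] at hx
  intro i
  have h0 := hx.1 i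
  have h1 := hx.2 i
  simp only [Pi.zero_apply, Pi.one_apply] at h0 h1
  have hd := sub_pos.2 (hab i)
  constructor <;> nlinarith

/-- The affine chart is continuous. [folklore] -/
theorem continuous_boxAff {N : ℕ} (a b : Fin N → ℝ) :
    Continuous (fun x : Fin N → ℝ => fun i => a i + (b i - a i) * x i) :=
  continuous_pi fun i => continuous_const.add (continuous_const.mul (continuous_apply i))

/-! ### Sorry-free glue, part 5: descent along one coordinate on a box -/

/-- **Descent along one coordinate `k` on an open box** from the three stubs: on
`∏ (aᵢ, bᵢ)`, an integrand `A'` which is `∂A/∂z_k` for a potential `A` semialgebraic and continuous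
on the closed box descends to the face representation `[open face box, A(z_k = b_k) − A(z_k = a_k)]`.
Stub 1 moves the bulk to the unit cube (Jacobian `J = ∏ (bᵢ − aᵢ)`) and the face to the unit
`n`-cube (Jacobian `J_k = ∏_{j ≠ k} (b_j − a_j)`); the cube potential `J_k · (A ∘ Φ)` has
`k`-derivative `J · (A' ∘ Φ)` (one-variable chain rule, `J = (b_k − a_k) J_k`) and faces
`J_k · A(z_k = b_k) ∘ Φ_k`, `J_k · A(z_k = a_k) ∘ Φ_k`; `cubeSingleCoordinateDescent` does the rest.
[cite: KontsevichZagier2001, §1.2] -/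
theorem boxSingleCoordinateDescent (h₁ : OpenBoxToCube) (h₂ : CubeCoordinateCycle)
    (h₃ : CubeLastNewtonLeibniz)
    (n : ℕ) (k : Fin (n + 1)) (a b : Fin (n + 1) → ℝ) (A A' : (Fin (n + 1) → ℝ) → ℝ)
    (R : KZ.IntegralRep (n + 1)) (s : KZ.IntegralRep n)
    (hab : ∀ i, a i < b i)
    (hRd : R.domain = {z | ∀ i, z i ∈ Set.Ioo (a i) (b i)})
    (hA : IsSemialgebraicFunOn ℚ {z | ∀ j, z j ∈ Set.Icc (a j) (b j)} A)
    (hAc : ContinuousOn A {z | ∀ j, z j ∈ Set.Icc (a j) (b j)})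
    (hder : ∀ z ∈ R.domain, HasDerivAt (fun t : ℝ => A (Function.update z k t)) (A' z) (z k))
    (hRi : Set.EqOn R.integrand A' R.domain)
    (hsd : s.domain = {y | ∀ j, y j ∈ Set.Ioo (a (Fin.succAbove k j)) (b (Fin.succAbove k j))})
    (hsi : Set.EqOn s.integrand (fun y => A (Fin.insertNth k (b k) y) - A (Fin.insertNth k (a k) y))
      s.domain) :
    KZ.of R - KZ.of s ∈ KZ.relations := by
  -- the corners are algebraic
  have halg : ∀ i, IsAlgebraic ℚ (a i) ∧ IsAlgebraic ℚ (b i) :=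
    isAlgebraic_corner_of_isSemialgebraic_openBox hab (hRd ▸ R.isSemialgebraic_domain)
  have habk : ∀ j : Fin n, a (k.succAbove j) < b (k.succAbove j) := fun j => hab _
  -- (i) stub 1 on the bulk and on the face
  obtain ⟨T, hTd, hTi, hRT⟩ :=
    h₁ (n + 1) a b R (fun i => (halg i).1) (fun i => (halg i).2) hab hRd
  obtain ⟨T', hT'd, hT'i, hsT'⟩ :=
    h₁ n (fun j => a (k.succAbove j)) (fun j => b (k.succAbove j)) s (fun j => (halg _).1)
      (fun j => (halg _).2) habk hsd
  -- Jacobians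
  set J : ℝ := ∏ i, (b i - a i) with hJ
  set Jk : ℝ := ∏ j : Fin n, (b (k.succAbove j) - a (k.succAbove j)) with hJk
  have hJJk : J = (b k - a k) * Jk := by
    rw [hJ, Fin.prod_univ_succAbove _ k]
  have hJk_alg : IsAlgebraic ℚ Jk :=
    boxAff_isAlgebraic_prod (fun j => (halg (k.succAbove j)).1) fun j => (halg (k.succAbove j)).2
  -- (ii) the cube potential `B = J_k · (A ∘ Φ)` and its data
  have hCube : IsSemialgebraic ℚ (Icc (0 : Fin (n + 1) → ℝ) 1) := by
    rw [← KZ.cube_eq_Icc]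
    exact KZ.isSemialgebraic_cube
  have hΦsa : IsSemialgebraicMapOn ℚ (Icc (0 : Fin (n + 1) → ℝ) 1)
      (fun x : Fin (n + 1) → ℝ => fun i => a i + (b i - a i) * x i) :=
    boxAff_isSemialgebraicMapOn hCube (fun i => (halg i).1) fun i => (halg i).2
  have hB : IsSemialgebraicFunOn ℚ (Icc (0 : Fin (n + 1) → ℝ) 1)
      (fun x => Jk * A (fun i => a i + (b i - a i) * x i)) :=
    (isSemialgebraicFunOn_const_of_isAlgebraic hCube hJk_alg).fun_mul
      ((IsSemialgebraicFunOn.comp_isSemialgebraicMapOn_holds hA hΦsa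
        fun x hx => boxAff_mem_closedBox hab hx).congr fun _ _ => rfl)
  have hBc : ContinuousOn (fun x => Jk * A (fun i => a i + (b i - a i) * x i))
      (Icc (0 : Fin (n + 1) → ℝ) 1) :=
    continuousOn_const.mul
      (hAc.comp (continuous_boxAff a b).continuousOn fun x hx => boxAff_mem_closedBox hab hx)
  have hder' : ∀ x ∈ T.domain,
      HasDerivAt (fun t : ℝ => Jk * A (fun i => a i + (b i - a i) * Function.update x k t i))
        (J * A' (fun i => a i + (b i - a i) * x i)) (x k) := by
    intro x hx
    rw [hTd] at hx
    have hΦx : (fun i => a i + (b i - a i) * x i) ∈ R.domain := by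
      rw [hRd]
      exact boxAff_mem_openBox hab hx
    have hg := hder _ hΦx
    have hh : HasDerivAt (fun t : ℝ => a k + (b k - a k) * t) (b k - a k) (x k) := by
      simpa using ((hasDerivAt_id (x k)).const_mul (b k - a k)).const_add (a k)
    have hcomp := hg.comp (x k) hh
    have hfun : (fun t : ℝ => Jk * A (fun i => a i + (b i - a i) * Function.update x k t i)) =
        fun t => Jk * ((fun t => A (Function.update (fun i => a i + (b i - a i) * x i) k t)) ∘
          (fun t => a k + (b k - a k) * t)) t := by
      funext t
      simp only [Function.comp_apply, boxAff_update]
    rw [hfun]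
    refine (hcomp.const_mul Jk).congr_deriv ?_
    rw [hJJk]
    ring
  have hTi' : EqOn T.integrand (fun x => J * A' (fun i => a i + (b i - a i) * x i)) T.domain := by
    intro x hx
    have hΦx : (fun i => a i + (b i - a i) * x i) ∈ R.domain := by
      rw [hRd]
      exact boxAff_mem_openBox hab (hTd ▸ hx)
    rw [hTi x hx, hRi hΦx]
  have hT'i' : EqOn T'.integrand
      (fun y => Jk * A (fun i => a i + (b i - a i) * (Fin.insertNth k 1 y : Fin (n + 1) → ℝ) i) -
        Jk * A (fun i => a i + (b i - a i) * (Fin.insertNth k 0 y : Fin (n + 1) → ℝ) i)) T'.domain := by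
    intro y hy
    have hΦy : (fun j => a (k.succAbove j) + (b (k.succAbove j) - a (k.succAbove j)) * y j) ∈
        s.domain := by
      rw [hsd]
      exact boxAff_mem_openBox habk (hT'd ▸ hy)
    have h1 : a k + (b k - a k) * 1 = b k := by ring
    have h0 : a k + (b k - a k) * 0 = a k := by ring
    simp only [boxAff_insertNth, h1, h0]
    rw [hT'i y hy, hsi hΦy]
    ring
  -- (iii) the cube engine between the two cubified representations
  have hmid : KZ.of T - KZ.of T' ∈ KZ.relations :=
    cubeSingleCoordinateDescent h₂ h₃ n k (fun x => Jk * A (fun i => a i + (b i - a i) * x i))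
      (fun x => J * A' (fun i => a i + (b i - a i) * x i)) T T' hTd hB hBc hder' hTi' hT'd hT'i'
  have key : KZ.of R - KZ.of s = (KZ.of R - KZ.of T) + (KZ.of T - KZ.of T') - (KZ.of s - KZ.of T') := by
    abel
  rw [key]
  exact KZ.relations.sub_mem (KZ.relations.add_mem hRT hmid) hsT'

/-! ### The assembly: the crux BY NAME from the three stub statements -/

/-- **Assembly.** `OpenBoxToCube → CubeCoordinateCycle → CubeLastNewtonLeibniz → ExactDescentBox`:
split `[box, ∑ᵢ ∂ᵢAᵢ]` into the pieces `[box, ∂ᵢAᵢ]` (iterated rule (1b), the tree theorem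
`KZ.of_sub_sum_integrand_mem_relations`), descend each piece along its own coordinate
(`boxSingleCoordinateDescent`), and add up in `KZ.relations`. -/
theorem ExactDescentBox_of (h₁ : OpenBoxToCube) (h₂ : CubeCoordinateCycle)
    (h₃ : CubeLastNewtonLeibniz) :
    Summit.KontsevichZagierPeriods.KontsevichZagierPeriods.Theses.GenericPointClass.ExactDescentBox := by
  intro n a b r A A' s hab hdom hA hAc hder hA' hint hsum hsd hsi
  -- the per-coordinate pieces `[box, ∂ᵢ Aᵢ]`
  let R : Fin (n + 1) → KZ.IntegralRep (n + 1) := fun i =>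
    { domain := r.domain
      integrand := A' i
      isSemialgebraic_domain := r.isSemialgebraic_domain
      isSemialgebraicFunOn_integrand := hA' i
      integrableOn := hint i }
  have hsplit : KZ.of r - ∑ i, KZ.of (R i) ∈ KZ.relations :=
    KZ.of_sub_sum_integrand_mem_relations Finset.univ R r (fun _ _ => rfl)
      (fun z hz => by simpa [R] using hsum hz)
  have hdesc : ∀ i, KZ.of (R i) - KZ.of (s i) ∈ KZ.relations := fun i =>
    boxSingleCoordinateDescent h₁ h₂ h₃ n i a b (A i) (A' i) (R i) (s i) hab hdom (hA i) (hAc i)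
      (hder i) (fun _ _ => rfl) (hsd i) (hsi i)
  have heq : KZ.of r - ∑ i, KZ.of (s i) =
      (KZ.of r - ∑ i, KZ.of (R i)) + ∑ i, (KZ.of (R i) - KZ.of (s i)) := by
    rw [Finset.sum_sub_distrib]
    abel
  rw [heq]
  exact KZ.relations.add_mem hsplit (sum_mem fun i _ => hdesc i)

/-- The crux from the registered stubs (uses the three `sorry`s above through the assembly; kept
as a type-level check that the stub signatures are exactly the assembly's hypotheses). -/
theorem ExactDescentBox_of_stubs :
    Summit.KontsevichZagierPeriods.KontsevichZagierPeriods.Theses.GenericPointClass.ExactDescentBox :=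
  ExactDescentBox_of stub_openBoxToCube stub_cubeCoordinateCycle stub_cubeLastNewtonLeibniz

end Summit.KontsevichZagierPeriods.KontsevichZagierPeriods.Cruxes.ExactDescentBox.AffineCube
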